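import Summits.CriticalPhenomena.PercolationContinuityZ3.Theorems.PercNearOneGluingNoHeavyLowerTailAntitheticTwoStageMixed
import HarnessLib

/-!
# `NoHeavyLowerTail` (stmt-CriticalPhenomena-4575) — antithetic cluster pairs: THEOREM 2T, the two-stage theorem with an ARBITRARY
# graph side — abstract core (HOME/THEOREM-2T.md, prim-hp-2 gen 61)

Support file (`--supports stmt-CriticalPhenomena-4575`, hull-port prover `prim-hp-2`, gen 61).  No definitions, no named facts, no sorries;
standard axioms.  VERTEX version.  Setting of …AntitheticTwoStageMixed (gen 60): side 2 is an abstract cube `T : Set ι ↦ (X₂ T, Y₂ T)`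
(`X₂` monotone, `Y₂` antitone, `Y₂ T = X₂ Tᶜ`), `U = {T : z ∉ Y₂ T}`, `cB = |Set ι|`, `cR = #U`; side 1 is a GRAPH side `E₁` with clusters
`X₁ ω = openCluster (ω ∩ E₁) s`, `Y₁ ω = openCluster (ωᶜ ∩ E₁) s`; `x` is the bonus vertex; `TIrow`, `TIIrow` as there.
**`Antithetic.TwoStage.free_mixed_bound`** = `TwoStage.mixed_bound` with the hypothesis `sy ∈ E₁` REMOVED: if side 2 is R-associated (`hR`)
then `0 ≤ Σ_{ω₁} ((cR/cB)·[y ∉ X₁ ω₁]·TIrow + [y ∈ X₁ ω₁]·TIIrow)` for EVERY edge set `E₁` and every `y`.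
Proof (HOME/THEOREM-2T.md §1): fold the sum by the complement involution of side 1 onto the half-cube `{ω₁ ∋ s(s,y)}` (a fundamental
domain whether or not `sy` is an edge); a folded row with pair `(P,Q)` has integrand `(cR/cB)·([y∉P]·Mb + [y∉Q]·M3) + [y∈P]·M4 + [y∈Q]·M1`,
i.e. one of FOUR mixtures of two stochastically ordered positively associated side-2 laws (classes `y ∈ P∖Q`, `y ∈ P∩Q`, `y ∉ P∪Q`,
`y ∈ Q∖P`), each bounded below by `2cR·𝒦₁𝒦₂(P,Q)` (Harris on `Set ι`, `hR`, the chain `TwoStage.constraint_chain`, a Chebyshev step);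
the piecewise function `𝒦 = ½(([y∈P] ? a : b) + ([y∉Q] ? c : d))` of the four normalised means is twisted-monotone and odd, so
`TwoStage.pinned_cube_sum_nonneg` (Harris on the half-cube) finishes.  The point missed in HOME/MEMO-gen60 §2: the folded field has
nonnegative means although the unfolded one does not.
[cite: VandenbergHaggstromKahn2005, §1 p. 6 ("Harris' inequality")]
-/

noncomputable section

namespace Summit.CriticalPhenomena.PercolationContinuityZ3.Theorems

open Literature.Probability.Percolation
open scoped Classical

namespace Antithetic

namespace TwoStage

variable {V : Type*} [Fintype V] {ι : Type*} [Fintype ι]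

/-- Folding a sum over all colourings onto the half-cube `{ω ∋ e}` by the complement involution. [folklore] -/
theorem sum_fold_compl (e : Sym2 V) (f : Set (Sym2 V) → ℝ) :
    ∑ ω : Set (Sym2 V), f ω = ∑ ω ∈ Finset.univ.filter (fun ω : Set (Sym2 V) => e ∈ ω), (f ω + f ωᶜ) := by
  rw [Finset.sum_add_distrib, ← Finset.sum_filter_add_sum_filter_not Finset.univ (fun ω : Set (Sym2 V) => e ∈ ω)]
  congr 1
  refine Finset.sum_nbij' (fun ω => ωᶜ) (fun ω => ωᶜ) ?_ ?_ ?_ ?_ ?_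
  · intro ω hω
    obtain ⟨_, h2⟩ := Finset.mem_filter.1 hω
    exact Finset.mem_filter.2 ⟨Finset.mem_univ _, Set.mem_compl h2⟩
  · intro ω hω
    obtain ⟨_, h2⟩ := Finset.mem_filter.1 hω
    exact Finset.mem_filter.2 ⟨Finset.mem_univ _, fun h => h h2⟩
  · intro ω _; exact compl_compl ω
  · intro ω _; exact compl_compl ω
  · intro ω _; rw [compl_compl]

section Setting

variable (X₂ Y₂ : Set ι → Set V) (hX : Monotone X₂) (hY : Antitone Y₂) (hXY : ∀ T, Y₂ T = X₂ Tᶜ) (x z : V)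
include hX hY hXY

/-- **THEOREM 2T, abstract core** (HOME/THEOREM-2T.md §1): the mixed two-stage bound
`0 ≤ Σ_{ω₁} ((cR/cB)·[y ∉ X₁ ω₁]·TIrow(ω₁) + [y ∈ X₁ ω₁]·TIIrow(ω₁))` for an ARBITRARY graph side `E₁` (no `sy ∈ E₁`, no nestedness)
and an R-associated abstract side 2. [this work] -/
theorem free_mixed_bound (E₁ : Set (Sym2 V)) (s y : V)
    (hR : ∀ Φ₁ Φ₂ : Set V → Set V → ℝ,
      (∀ ⦃A A' B B' : Set V⦄, A ⊆ A' → B' ⊆ B → Φ₁ A B ≤ Φ₁ A' B') → (∀ ⦃A A' B B' : Set V⦄, A ⊆ A' → B' ⊆ B → Φ₂ A B ≤ Φ₂ A' B') →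
      (∑ T ∈ Finset.univ.filter (fun T : Set ι => z ∉ Y₂ T), Φ₁ (X₂ T) (Y₂ T)) *
          (∑ T ∈ Finset.univ.filter (fun T : Set ι => z ∉ Y₂ T), Φ₂ (X₂ T) (Y₂ T)) ≤
        ((Finset.univ.filter fun T : Set ι => z ∉ Y₂ T).card : ℝ) *
          ∑ T ∈ Finset.univ.filter (fun T : Set ι => z ∉ Y₂ T), Φ₁ (X₂ T) (Y₂ T) * Φ₂ (X₂ T) (Y₂ T))
    (hcR : 0 < (Finset.univ.filter fun T : Set ι => z ∉ Y₂ T).card)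
    {h₁ h₂ : Set V → Set V → ℝ}
    (hh₁ : ∀ ⦃A A' B B' : Set V⦄, A ⊆ A' → B' ⊆ B → h₁ A B ≤ h₁ A' B') (hh₂ : ∀ ⦃A A' B B' : Set V⦄, A ⊆ A' → B' ⊆ B → h₂ A B ≤ h₂ A' B')
    (hodd₁ : ∀ A B, h₁ B A = -h₁ A B) (hodd₂ : ∀ A B, h₂ B A = -h₂ A B) :
    0 ≤ ∑ ω₁ : Set (Sym2 V),
      ((((Finset.univ.filter fun T : Set ι => z ∉ Y₂ T).card : ℝ) / (Fintype.card (Set ι) : ℝ)) *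
          (if y ∉ openCluster (ω₁ ∩ E₁) s then
            ∑ T : Set ι, h₁ (openCluster (ω₁ ∩ E₁) s ∪ X₂ T) (openCluster (ω₁ᶜ ∩ E₁) s ∪ Y₂ T ∪ {v | v ∈ ({x} : Set V) ∧ z ∈ Y₂ T}) *
              h₂ (openCluster (ω₁ ∩ E₁) s ∪ X₂ T) (openCluster (ω₁ᶜ ∩ E₁) s ∪ Y₂ T ∪ {v | v ∈ ({x} : Set V) ∧ z ∈ Y₂ T})
          else 0) +
        (if y ∈ openCluster (ω₁ ∩ E₁) s then
            ∑ T ∈ Finset.univ.filter (fun T : Set ι => z ∉ Y₂ T),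
              h₁ (openCluster (ω₁ ∩ E₁) s ∪ X₂ T ∪ {x}) (openCluster (ω₁ᶜ ∩ E₁) s ∪ Y₂ T) *
                h₂ (openCluster (ω₁ ∩ E₁) s ∪ X₂ T ∪ {x}) (openCluster (ω₁ᶜ ∩ E₁) s ∪ Y₂ T)
          else 0)) := by
  -- constants
  set U : Finset (Set ι) := Finset.univ.filter (fun T : Set ι => z ∉ Y₂ T) with hUdef
  set cR : ℝ := (U.card : ℝ) with hcRdef
  set cB : ℝ := (Fintype.card (Set ι) : ℝ) with hcBdef
  have hcRpos : 0 < cR := by rw [hcRdef]; exact_mod_cast hcR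
  have hcBpos : 0 < cB := by rw [hcBdef]; exact_mod_cast Fintype.card_pos
  have hXc : ∀ T, X₂ Tᶜ = Y₂ T := fun T => (hXY T).symm
  have hYc : ∀ T, Y₂ Tᶜ = X₂ T := fun T => by rw [hXY, compl_compl]
  -- side 1
  let X₁ : Set (Sym2 V) → Set V := fun ω => openCluster (ω ∩ E₁) s
  let Y₁ : Set (Sym2 V) → Set V := fun ω => openCluster (ωᶜ ∩ E₁) s
  have hX₁c : ∀ ω, X₁ ωᶜ = Y₁ ω := fun ω => rfl
  have hY₁c : ∀ ω, Y₁ ωᶜ = X₁ ω := fun ω => by show openCluster (ωᶜᶜ ∩ E₁) s = _; rw [compl_compl]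
  -- the four row integrals as functions of a pair
  let Mb : Set V → Set V → ℝ := fun P Q =>
    ∑ T : Set ι, h₁ (P ∪ X₂ T) (Q ∪ Y₂ T ∪ {v | v ∈ ({x} : Set V) ∧ z ∈ Y₂ T}) * h₂ (P ∪ X₂ T) (Q ∪ Y₂ T ∪ {v | v ∈ ({x} : Set V) ∧ z ∈ Y₂ T})
  let M3 : Set V → Set V → ℝ := fun P Q =>
    ∑ T : Set ι, h₁ (P ∪ X₂ T ∪ {v | v ∈ ({x} : Set V) ∧ z ∈ X₂ T}) (Q ∪ Y₂ T) * h₂ (P ∪ X₂ T ∪ {v | v ∈ ({x} : Set V) ∧ z ∈ X₂ T}) (Q ∪ Y₂ T)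
  let M4 : Set V → Set V → ℝ := fun P Q => ∑ T ∈ U, h₁ (P ∪ X₂ T ∪ {x}) (Q ∪ Y₂ T) * h₂ (P ∪ X₂ T ∪ {x}) (Q ∪ Y₂ T)
  let M1 : Set V → Set V → ℝ := fun P Q => ∑ T ∈ U, h₁ (P ∪ Y₂ T) (Q ∪ X₂ T ∪ {x}) * h₂ (P ∪ Y₂ T) (Q ∪ X₂ T ∪ {x})
  -- the single-function averages (unnormalised)
  let Gb : (Set V → Set V → ℝ) → Set V → Set V → ℝ := fun h P Q =>
    ∑ T : Set ι, h (P ∪ X₂ T) (Q ∪ Y₂ T ∪ {v | v ∈ ({x} : Set V) ∧ z ∈ Y₂ T})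
  let Gt : (Set V → Set V → ℝ) → Set V → Set V → ℝ := fun h P Q => ∑ T ∈ U, h (P ∪ X₂ T ∪ {x}) (Q ∪ Y₂ T)
  -- Step 0a: Mb Q P = M3 P Q (involution `T ↦ Tᶜ` on side 2 + oddness)
  have hsumc : ∀ f : Set ι → ℝ, ∑ T : Set ι, f Tᶜ = ∑ T : Set ι, f T := fun f =>
    Fintype.sum_equiv (Function.Involutive.toPerm (compl : Set ι → Set ι) compl_involutive) (fun T => f Tᶜ) f (fun _ => rfl)
  have h0a : ∀ P Q, Mb Q P = M3 P Q := by
    intro P Q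
    show ∑ T : Set ι, h₁ (Q ∪ X₂ T) (P ∪ Y₂ T ∪ {v | v ∈ ({x} : Set V) ∧ z ∈ Y₂ T}) * h₂ (Q ∪ X₂ T) (P ∪ Y₂ T ∪ {v | v ∈ ({x} : Set V) ∧ z ∈ Y₂ T}) =
      ∑ T : Set ι, h₁ (P ∪ X₂ T ∪ {v | v ∈ ({x} : Set V) ∧ z ∈ X₂ T}) (Q ∪ Y₂ T) * h₂ (P ∪ X₂ T ∪ {v | v ∈ ({x} : Set V) ∧ z ∈ X₂ T}) (Q ∪ Y₂ T)
    rw [← hsumc (fun T => h₁ (P ∪ X₂ T ∪ {v | v ∈ ({x} : Set V) ∧ z ∈ X₂ T}) (Q ∪ Y₂ T) * h₂ (P ∪ X₂ T ∪ {v | v ∈ ({x} : Set V) ∧ z ∈ X₂ T}) (Q ∪ Y₂ T))]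
    refine Finset.sum_congr rfl fun T _ => ?_
    show _ = h₁ (P ∪ X₂ Tᶜ ∪ {v | v ∈ ({x} : Set V) ∧ z ∈ X₂ Tᶜ}) (Q ∪ Y₂ Tᶜ) * h₂ (P ∪ X₂ Tᶜ ∪ {v | v ∈ ({x} : Set V) ∧ z ∈ X₂ Tᶜ}) (Q ∪ Y₂ Tᶜ)
    rw [hXc, hYc, hodd₁ (P ∪ Y₂ T ∪ _) (Q ∪ X₂ T), hodd₂ (P ∪ Y₂ T ∪ _) (Q ∪ X₂ T)]
    ring
  -- Step 0b: M4 Q P = M1 P Q (oddness)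
  have h0b : ∀ P Q, M4 Q P = M1 P Q := by
    intro P Q
    refine Finset.sum_congr rfl fun T _ => ?_
    rw [hodd₁ (P ∪ Y₂ T) (Q ∪ X₂ T ∪ {x}), hodd₂ (P ∪ Y₂ T) (Q ∪ X₂ T ∪ {x})]
    ring
  -- the same for single functions
  have hGb : ∀ (h : Set V → Set V → ℝ), (∀ A B, h B A = -h A B) → ∀ P Q,
      Gb h Q P = -∑ T : Set ι, h (P ∪ X₂ T ∪ {v | v ∈ ({x} : Set V) ∧ z ∈ X₂ T}) (Q ∪ Y₂ T) := by
    intro h hodd P Q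
    show ∑ T : Set ι, h (Q ∪ X₂ T) (P ∪ Y₂ T ∪ {v | v ∈ ({x} : Set V) ∧ z ∈ Y₂ T}) = _
    rw [← hsumc (fun T => h (P ∪ X₂ T ∪ {v | v ∈ ({x} : Set V) ∧ z ∈ X₂ T}) (Q ∪ Y₂ T)), ← Finset.sum_neg_distrib]
    refine Finset.sum_congr rfl fun T _ => ?_
    show _ = -h (P ∪ X₂ Tᶜ ∪ {v | v ∈ ({x} : Set V) ∧ z ∈ X₂ Tᶜ}) (Q ∪ Y₂ Tᶜ)
    rw [hXc, hYc, hodd (P ∪ Y₂ T ∪ _) (Q ∪ X₂ T)]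
  have hGt : ∀ (h : Set V → Set V → ℝ), (∀ A B, h B A = -h A B) → ∀ P Q,
      Gt h Q P = -∑ T ∈ U, h (P ∪ Y₂ T) (Q ∪ X₂ T ∪ {x}) := by
    intro h hodd P Q
    show ∑ T ∈ U, h (Q ∪ X₂ T ∪ {x}) (P ∪ Y₂ T) = _
    rw [← Finset.sum_neg_distrib]
    exact Finset.sum_congr rfl fun T _ => by rw [hodd (P ∪ Y₂ T) (Q ∪ X₂ T ∪ {x})]
  -- the chain (𝒞)
  have hC := fun (h : Set V → Set V → ℝ) (hh : ∀ ⦃A A' B B' : Set V⦄, A ⊆ A' → B' ⊆ B → h A B ≤ h A' B')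
    (hodd : ∀ A B, h B A = -h A B) (P Q : Set V) => constraint_chain X₂ Y₂ hX hY hXY x z hh hodd P Q
  -- normalised averages a (= g̃), b (= ḡ), c (= −ḡ∘swap), d (= −g̃∘swap)
  let a : (Set V → Set V → ℝ) → Set V → Set V → ℝ := fun h P Q => Gt h P Q / cR
  let b : (Set V → Set V → ℝ) → Set V → Set V → ℝ := fun h P Q => Gb h P Q / cB
  let c : (Set V → Set V → ℝ) → Set V → Set V → ℝ := fun h P Q => -Gb h Q P / cB
  let d : (Set V → Set V → ℝ) → Set V → Set V → ℝ := fun h P Q => -Gt h Q P / cR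
  -- the chain, normalised: d ≤ b ≤ c ≤ a pointwise
  have hdb : ∀ (h : Set V → Set V → ℝ), (∀ ⦃A A' B B' : Set V⦄, A ⊆ A' → B' ⊆ B → h A B ≤ h A' B') → (∀ A B, h B A = -h A B) →
      ∀ P Q, d h P Q ≤ b h P Q := by
    intro h hh hodd P Q
    obtain ⟨c1, _, _⟩ := hC h hh hodd P Q
    rw [← hUdef, ← hcBdef, ← hcRdef] at c1
    show -Gt h Q P / cR ≤ Gb h P Q / cB
    rw [div_le_div_iff₀ hcRpos hcBpos]
    show -(∑ T ∈ U, h (Q ∪ X₂ T ∪ {x}) (P ∪ Y₂ T)) * cB ≤ (∑ T : Set ι, h (P ∪ X₂ T) (Q ∪ Y₂ T ∪ {v | v ∈ ({x} : Set V) ∧ z ∈ Y₂ T})) * cR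
    linarith
  have hbc : ∀ (h : Set V → Set V → ℝ), (∀ ⦃A A' B B' : Set V⦄, A ⊆ A' → B' ⊆ B → h A B ≤ h A' B') → (∀ A B, h B A = -h A B) →
      ∀ P Q, b h P Q ≤ c h P Q := by
    intro h hh hodd P Q
    obtain ⟨_, c2, _⟩ := hC h hh hodd P Q
    show Gb h P Q / cB ≤ -Gb h Q P / cB
    rw [div_le_div_iff_of_pos_right hcBpos]
    show (∑ T : Set ι, h (P ∪ X₂ T) (Q ∪ Y₂ T ∪ {v | v ∈ ({x} : Set V) ∧ z ∈ Y₂ T})) ≤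
      -(∑ T : Set ι, h (Q ∪ X₂ T) (P ∪ Y₂ T ∪ {v | v ∈ ({x} : Set V) ∧ z ∈ Y₂ T}))
    linarith
  have hca : ∀ (h : Set V → Set V → ℝ), (∀ ⦃A A' B B' : Set V⦄, A ⊆ A' → B' ⊆ B → h A B ≤ h A' B') → (∀ A B, h B A = -h A B) →
      ∀ P Q, c h P Q ≤ a h P Q := by
    intro h hh hodd P Q
    obtain ⟨_, _, c3⟩ := hC h hh hodd P Q
    rw [← hUdef, ← hcBdef, ← hcRdef] at c3
    show -Gb h Q P / cB ≤ Gt h P Q / cR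
    rw [div_le_div_iff₀ hcBpos hcRpos]
    show -(∑ T : Set ι, h (Q ∪ X₂ T) (P ∪ Y₂ T ∪ {v | v ∈ ({x} : Set V) ∧ z ∈ Y₂ T})) * cR ≤ (∑ T ∈ U, h (P ∪ X₂ T ∪ {x}) (Q ∪ Y₂ T)) * cB
    linarith
  have hba : ∀ (h : Set V → Set V → ℝ), (∀ ⦃A A' B B' : Set V⦄, A ⊆ A' → B' ⊆ B → h A B ≤ h A' B') → (∀ A B, h B A = -h A B) →
      ∀ P Q, b h P Q ≤ a h P Q := fun h hh hodd P Q => (hbc h hh hodd P Q).trans (hca h hh hodd P Q)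
  have hda : ∀ (h : Set V → Set V → ℝ), (∀ ⦃A A' B B' : Set V⦄, A ⊆ A' → B' ⊆ B → h A B ≤ h A' B') → (∀ A B, h B A = -h A B) →
      ∀ P Q, d h P Q ≤ a h P Q := fun h hh hodd P Q => (hdb h hh hodd P Q).trans (hba h hh hodd P Q)
  -- unnormalised single sums in terms of a, b, c, d
  have ea : ∀ (h : Set V → Set V → ℝ) (P Q : Set V), ∑ T ∈ U, h (P ∪ X₂ T ∪ {x}) (Q ∪ Y₂ T) = cR * a h P Q := by
    intro h P Q; show Gt h P Q = cR * (Gt h P Q / cR); field_simp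
  have eb : ∀ (h : Set V → Set V → ℝ) (P Q : Set V),
      ∑ T : Set ι, h (P ∪ X₂ T) (Q ∪ Y₂ T ∪ {v | v ∈ ({x} : Set V) ∧ z ∈ Y₂ T}) = cB * b h P Q := by
    intro h P Q; show Gb h P Q = cB * (Gb h P Q / cB); field_simp
  have ec : ∀ (h : Set V → Set V → ℝ), (∀ A B, h B A = -h A B) → ∀ (P Q : Set V),
      ∑ T : Set ι, h (P ∪ X₂ T ∪ {v | v ∈ ({x} : Set V) ∧ z ∈ X₂ T}) (Q ∪ Y₂ T) = cB * c h P Q := by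
    intro h hodd P Q; show _ = cB * (-Gb h Q P / cB); rw [hGb h hodd P Q]; field_simp
  have ed : ∀ (h : Set V → Set V → ℝ), (∀ A B, h B A = -h A B) → ∀ (P Q : Set V),
      ∑ T ∈ U, -h (P ∪ Y₂ T) (Q ∪ X₂ T ∪ {x}) = -(cR * d h P Q) := by
    intro h hodd P Q; show _ = -(cR * (-Gt h Q P / cR)); rw [hGt h hodd P Q, Finset.sum_neg_distrib]; field_simp
  -- Harris / R-association for the four integrands
  have hmonoB : ∀ (h : Set V → Set V → ℝ), (∀ ⦃A A' B B' : Set V⦄, A ⊆ A' → B' ⊆ B → h A B ≤ h A' B') → ∀ P Q : Set V,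
      Monotone (fun T : Set ι => h (P ∪ X₂ T) (Q ∪ Y₂ T ∪ {v | v ∈ ({x} : Set V) ∧ z ∈ Y₂ T})) := by
    intro h hh P Q T T' hTT'
    exact hh (Set.union_subset_union_right _ (hX hTT'))
      (Set.union_subset_union (Set.union_subset_union_right _ (hY hTT')) (fun v hv => ⟨hv.1, hY hTT' hv.2⟩))
  have hmono3 : ∀ (h : Set V → Set V → ℝ), (∀ ⦃A A' B B' : Set V⦄, A ⊆ A' → B' ⊆ B → h A B ≤ h A' B') → ∀ P Q : Set V,
      Monotone (fun T : Set ι => h (P ∪ X₂ T ∪ {v | v ∈ ({x} : Set V) ∧ z ∈ X₂ T}) (Q ∪ Y₂ T)) := by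
    intro h hh P Q T T' hTT'
    exact hh (Set.union_subset_union (Set.union_subset_union_right _ (hX hTT')) (fun v hv => ⟨hv.1, hX hTT' hv.2⟩))
      (Set.union_subset_union_right _ (hY hTT'))
  have hMb : ∀ P Q, cB * (b h₁ P Q * b h₂ P Q) ≤ Mb P Q := by
    intro P Q
    have hH := harris_div (hmonoB h₁ hh₁ P Q) (hmonoB h₂ hh₂ P Q)
    rw [eb h₁, eb h₂, ← hcBdef] at hH
    have : cB * b h₁ P Q * (cB * b h₂ P Q) / cB = cB * (b h₁ P Q * b h₂ P Q) := by field_simp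
    rw [this] at hH; exact hH
  have hM3 : ∀ P Q, cB * (c h₁ P Q * c h₂ P Q) ≤ M3 P Q := by
    intro P Q
    have hH := harris_div (hmono3 h₁ hh₁ P Q) (hmono3 h₂ hh₂ P Q)
    rw [ec h₁ hodd₁, ec h₂ hodd₂, ← hcBdef] at hH
    have : cB * c h₁ P Q * (cB * c h₂ P Q) / cB = cB * (c h₁ P Q * c h₂ P Q) := by field_simp
    rw [this] at hH; exact hH
  have hM4 : ∀ P Q, cR * (a h₁ P Q * a h₂ P Q) ≤ M4 P Q := by
    intro P Q
    have hH := hR (fun A B => h₁ (P ∪ A ∪ {x}) (Q ∪ B)) (fun A B => h₂ (P ∪ A ∪ {x}) (Q ∪ B))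
      (fun A A' B B' hA hB => hh₁ (Set.union_subset_union_left _ (Set.union_subset_union_right _ hA)) (Set.union_subset_union_right _ hB))
      (fun A A' B B' hA hB => hh₂ (Set.union_subset_union_left _ (Set.union_subset_union_right _ hA)) (Set.union_subset_union_right _ hB))
    rw [ea h₁, ea h₂] at hH
    have : cR * a h₁ P Q * (cR * a h₂ P Q) = cR * (cR * (a h₁ P Q * a h₂ P Q)) := by ring
    rw [this] at hH
    exact le_of_mul_le_mul_left hH hcRpos
  have hM1 : ∀ P Q, cR * (d h₁ P Q * d h₂ P Q) ≤ M1 P Q := by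
    intro P Q
    have hH := hR (fun A B => -h₁ (P ∪ B) (Q ∪ A ∪ {x})) (fun A B => -h₂ (P ∪ B) (Q ∪ A ∪ {x}))
      (fun A A' B B' hA hB => neg_le_neg (hh₁ (Set.union_subset_union_right _ hB) (Set.union_subset_union_left _ (Set.union_subset_union_right _ hA))))
      (fun A A' B B' hA hB => neg_le_neg (hh₂ (Set.union_subset_union_right _ hB) (Set.union_subset_union_left _ (Set.union_subset_union_right _ hA))))
    have e3 : ∑ T ∈ U, -h₁ (P ∪ Y₂ T) (Q ∪ X₂ T ∪ {x}) * -h₂ (P ∪ Y₂ T) (Q ∪ X₂ T ∪ {x}) = M1 P Q :=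
      Finset.sum_congr rfl fun T _ => by ring
    rw [ed h₁ hodd₁, ed h₂ hodd₂, e3] at hH
    have : -(cR * d h₁ P Q) * -(cR * d h₂ P Q) = cR * (cR * (d h₁ P Q * d h₂ P Q)) := by ring
    rw [this] at hH
    exact le_of_mul_le_mul_left hH hcRpos
  -- Step 1: the four per-row lower bounds
  have hrowA : ∀ P Q, cR / cB * M3 P Q + M4 P Q ≥ 2 * cR * (((a h₁ P Q + c h₁ P Q) / 2) * ((a h₂ P Q + c h₂ P Q) / 2)) := by
    intro P Q
    have hmix := mix_two (hca h₁ hh₁ hodd₁ P Q) (hca h₂ hh₂ hodd₂ P Q)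
    have e5 : cR / cB * (cB * (c h₁ P Q * c h₂ P Q)) = cR * (c h₁ P Q * c h₂ P Q) := by field_simp
    have hM3' : cR * (c h₁ P Q * c h₂ P Q) ≤ cR / cB * M3 P Q := by
      rw [← e5]; exact mul_le_mul_of_nonneg_left (hM3 P Q) (div_nonneg hcRpos.le hcBpos.le)
    nlinarith [mul_le_mul_of_nonneg_left hmix hcRpos.le, hM4 P Q]
  have hrowM : ∀ P Q, M4 P Q + M1 P Q ≥ 2 * cR * (((a h₁ P Q + d h₁ P Q) / 2) * ((a h₂ P Q + d h₂ P Q) / 2)) := by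
    intro P Q
    have hmix := mix_two (hda h₁ hh₁ hodd₁ P Q) (hda h₂ hh₂ hodd₂ P Q)
    nlinarith [mul_le_mul_of_nonneg_left hmix hcRpos.le, hM4 P Q, hM1 P Q]
  have hrowN : ∀ P Q, cR / cB * (Mb P Q + M3 P Q) ≥ 2 * cR * (((b h₁ P Q + c h₁ P Q) / 2) * ((b h₂ P Q + c h₂ P Q) / 2)) := by
    intro P Q
    have hmix := mix_two (hbc h₁ hh₁ hodd₁ P Q) (hbc h₂ hh₂ hodd₂ P Q)
    have e5 : cR / cB * (cB * (c h₁ P Q * c h₂ P Q) + cB * (b h₁ P Q * b h₂ P Q)) = cR * (c h₁ P Q * c h₂ P Q + b h₁ P Q * b h₂ P Q) := by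
      field_simp
    have hle : cR * (c h₁ P Q * c h₂ P Q + b h₁ P Q * b h₂ P Q) ≤ cR / cB * (Mb P Q + M3 P Q) := by
      rw [← e5]; exact mul_le_mul_of_nonneg_left (by linarith [hM3 P Q, hMb P Q]) (div_nonneg hcRpos.le hcBpos.le)
    nlinarith [mul_le_mul_of_nonneg_left hmix hcRpos.le]
  have hrowC : ∀ P Q, cR / cB * Mb P Q + M1 P Q ≥ 2 * cR * (((b h₁ P Q + d h₁ P Q) / 2) * ((b h₂ P Q + d h₂ P Q) / 2)) := by
    intro P Q
    have hmix := mix_two (hdb h₁ hh₁ hodd₁ P Q) (hdb h₂ hh₂ hodd₂ P Q)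
    have e5 : cR / cB * (cB * (b h₁ P Q * b h₂ P Q)) = cR * (b h₁ P Q * b h₂ P Q) := by field_simp
    have hMb' : cR * (b h₁ P Q * b h₂ P Q) ≤ cR / cB * Mb P Q := by
      rw [← e5]; exact mul_le_mul_of_nonneg_left (hMb P Q) (div_nonneg hcRpos.le hcBpos.le)
    nlinarith [mul_le_mul_of_nonneg_left hmix hcRpos.le, hM1 P Q]
  -- Step 2: the piecewise function 𝒦 is twisted-monotone and (super-)odd; Harris on the half-cube
  let K : (Set V → Set V → ℝ) → Set V → Set V → ℝ := fun h P Q =>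
    ((if y ∈ P then a h P Q else b h P Q) + (if y ∉ Q then c h P Q else d h P Q)) / 2
  have hamono : ∀ (h : Set V → Set V → ℝ), (∀ ⦃A A' B B' : Set V⦄, A ⊆ A' → B' ⊆ B → h A B ≤ h A' B') →
      ∀ ⦃A A' B B' : Set V⦄, A ⊆ A' → B' ⊆ B → a h A B ≤ a h A' B' := by
    intro h hh A A' B B' hA hB
    show Gt h A B / cR ≤ Gt h A' B' / cR
    exact div_le_div_of_nonneg_right (by have := Gt_mono X₂ Y₂ x z hh hA hB; rw [← hUdef] at this; exact this) hcRpos.le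
  have hbmono : ∀ (h : Set V → Set V → ℝ), (∀ ⦃A A' B B' : Set V⦄, A ⊆ A' → B' ⊆ B → h A B ≤ h A' B') →
      ∀ ⦃A A' B B' : Set V⦄, A ⊆ A' → B' ⊆ B → b h A B ≤ b h A' B' := by
    intro h hh A A' B B' hA hB
    show Gb h A B / cB ≤ Gb h A' B' / cB
    exact div_le_div_of_nonneg_right (Gb_mono X₂ Y₂ x z hh hA hB) hcBpos.le
  have hcmono : ∀ (h : Set V → Set V → ℝ), (∀ ⦃A A' B B' : Set V⦄, A ⊆ A' → B' ⊆ B → h A B ≤ h A' B') →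
      ∀ ⦃A A' B B' : Set V⦄, A ⊆ A' → B' ⊆ B → c h A B ≤ c h A' B' := by
    intro h hh A A' B B' hA hB
    show -Gb h B A / cB ≤ -Gb h B' A' / cB
    exact div_le_div_of_nonneg_right (neg_le_neg (Gb_mono X₂ Y₂ x z hh hB hA)) hcBpos.le
  have hdmono : ∀ (h : Set V → Set V → ℝ), (∀ ⦃A A' B B' : Set V⦄, A ⊆ A' → B' ⊆ B → h A B ≤ h A' B') →
      ∀ ⦃A A' B B' : Set V⦄, A ⊆ A' → B' ⊆ B → d h A B ≤ d h A' B' := by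
    intro h hh A A' B B' hA hB
    show -Gt h B A / cR ≤ -Gt h B' A' / cR
    exact div_le_div_of_nonneg_right (neg_le_neg (by have := Gt_mono X₂ Y₂ x z hh hB hA; rw [← hUdef] at this; exact this)) hcRpos.le
  have hKmono : ∀ (h : Set V → Set V → ℝ), (∀ ⦃A A' B B' : Set V⦄, A ⊆ A' → B' ⊆ B → h A B ≤ h A' B') → (∀ A B, h B A = -h A B) →
      ∀ ⦃A A' B B' : Set V⦄, A ⊆ A' → B' ⊆ B → K h A B ≤ K h A' B' := by
    intro h hh hodd A A' B B' hA hB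
    show ((if y ∈ A then a h A B else b h A B) + (if y ∉ B then c h A B else d h A B)) / 2 ≤
      ((if y ∈ A' then a h A' B' else b h A' B') + (if y ∉ B' then c h A' B' else d h A' B')) / 2
    have h1 : (if y ∈ A then a h A B else b h A B) ≤ (if y ∈ A' then a h A' B' else b h A' B') := by
      by_cases hyA : y ∈ A
      · rw [if_pos hyA, if_pos (hA hyA)]; exact hamono h hh hA hB
      · by_cases hyA' : y ∈ A'
        · rw [if_neg hyA, if_pos hyA']; exact (hba h hh hodd A B).trans (hamono h hh hA hB)
        · rw [if_neg hyA, if_neg hyA']; exact hbmono h hh hA hB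
    have h2 : (if y ∉ B then c h A B else d h A B) ≤ (if y ∉ B' then c h A' B' else d h A' B') := by
      by_cases hyB : y ∈ B
      · by_cases hyB' : y ∈ B'
        · rw [if_neg (not_not.2 hyB), if_neg (not_not.2 hyB')]; exact hdmono h hh hA hB
        · rw [if_neg (not_not.2 hyB), if_pos hyB']; exact (hdb h hh hodd A B).trans ((hbc h hh hodd A B).trans (hcmono h hh hA hB))
      · have hyB' : y ∉ B' := fun h' => hyB (hB h')
        rw [if_pos hyB, if_pos hyB']; exact hcmono h hh hA hB
    linarith
  have hKso : ∀ (h : Set V → Set V → ℝ), ∀ A B, 0 ≤ K h A B + K h B A := by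
    intro h A B
    show 0 ≤ ((if y ∈ A then a h A B else b h A B) + (if y ∉ B then c h A B else d h A B)) / 2 +
      ((if y ∈ B then a h B A else b h B A) + (if y ∉ A then c h B A else d h B A)) / 2
    have g1 : (if y ∈ A then a h A B else b h A B) + (if y ∉ A then c h B A else d h B A) = 0 := by
      by_cases hyA : y ∈ A
      · rw [if_pos hyA, if_neg (not_not.2 hyA)]; show Gt h A B / cR + -Gt h A B / cR = 0; ring
      · rw [if_neg hyA, if_pos hyA]; show Gb h A B / cB + -Gb h A B / cB = 0; ring
    have g2 : (if y ∈ B then a h B A else b h B A) + (if y ∉ B then c h A B else d h A B) = 0 := by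
      by_cases hyB : y ∈ B
      · rw [if_pos hyB, if_neg (not_not.2 hyB)]; show Gt h B A / cR + -Gt h B A / cR = 0; ring
      · rw [if_neg hyB, if_pos hyB]; show Gb h B A / cB + -Gb h B A / cB = 0; ring
    linarith
  have hcube := pinned_cube_sum_nonneg E₁ s s(s, y) (hKmono h₁ hh₁ hodd₁) (hKso h₁) (hKmono h₂ hh₂ hodd₂) (hKso h₂)
  -- Step 0c: fold the target onto the half-cube `{ω₁ ∋ s(s,y)}`
  let ROW : Set V → Set V → ℝ := fun P Q =>
    cR / cB * ((if y ∉ P then Mb P Q else 0) + (if y ∉ Q then M3 P Q else 0)) + ((if y ∈ P then M4 P Q else 0) + (if y ∈ Q then M1 P Q else 0))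
  have hre : ∑ ω₁ : Set (Sym2 V), (cR / cB * (if y ∉ X₁ ω₁ then Mb (X₁ ω₁) (Y₁ ω₁) else 0) + (if y ∈ X₁ ω₁ then M4 (X₁ ω₁) (Y₁ ω₁) else 0)) =
      ∑ ω₁ ∈ Finset.univ.filter (fun ω₁ : Set (Sym2 V) => s(s, y) ∈ ω₁), ROW (X₁ ω₁) (Y₁ ω₁) := by
    rw [sum_fold_compl s(s, y)]
    refine Finset.sum_congr rfl fun ω₁ _ => ?_
    show (cR / cB * (if y ∉ X₁ ω₁ then Mb (X₁ ω₁) (Y₁ ω₁) else 0) + (if y ∈ X₁ ω₁ then M4 (X₁ ω₁) (Y₁ ω₁) else 0)) +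
        (cR / cB * (if y ∉ X₁ ω₁ᶜ then Mb (X₁ ω₁ᶜ) (Y₁ ω₁ᶜ) else 0) + (if y ∈ X₁ ω₁ᶜ then M4 (X₁ ω₁ᶜ) (Y₁ ω₁ᶜ) else 0)) =
      cR / cB * ((if y ∉ X₁ ω₁ then Mb (X₁ ω₁) (Y₁ ω₁) else 0) + (if y ∉ Y₁ ω₁ then M3 (X₁ ω₁) (Y₁ ω₁) else 0)) +
        ((if y ∈ X₁ ω₁ then M4 (X₁ ω₁) (Y₁ ω₁) else 0) + (if y ∈ Y₁ ω₁ then M1 (X₁ ω₁) (Y₁ ω₁) else 0))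
    rw [hX₁c, hY₁c, h0a (X₁ ω₁) (Y₁ ω₁), h0b (X₁ ω₁) (Y₁ ω₁)]
    ring
  -- Step 3: assemble
  have hmain : 0 ≤ ∑ ω₁ ∈ Finset.univ.filter (fun ω₁ : Set (Sym2 V) => s(s, y) ∈ ω₁), ROW (X₁ ω₁) (Y₁ ω₁) := by
    have hle : ∑ ω₁ ∈ Finset.univ.filter (fun ω₁ : Set (Sym2 V) => s(s, y) ∈ ω₁), 2 * cR * (K h₁ (X₁ ω₁) (Y₁ ω₁) * K h₂ (X₁ ω₁) (Y₁ ω₁)) ≤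
        ∑ ω₁ ∈ Finset.univ.filter (fun ω₁ : Set (Sym2 V) => s(s, y) ∈ ω₁), ROW (X₁ ω₁) (Y₁ ω₁) := by
      refine Finset.sum_le_sum fun ω₁ _ => ?_
      show 2 * cR * ((((if y ∈ X₁ ω₁ then a h₁ (X₁ ω₁) (Y₁ ω₁) else b h₁ (X₁ ω₁) (Y₁ ω₁)) +
            (if y ∉ Y₁ ω₁ then c h₁ (X₁ ω₁) (Y₁ ω₁) else d h₁ (X₁ ω₁) (Y₁ ω₁))) / 2) *
          (((if y ∈ X₁ ω₁ then a h₂ (X₁ ω₁) (Y₁ ω₁) else b h₂ (X₁ ω₁) (Y₁ ω₁)) +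
            (if y ∉ Y₁ ω₁ then c h₂ (X₁ ω₁) (Y₁ ω₁) else d h₂ (X₁ ω₁) (Y₁ ω₁))) / 2)) ≤
        cR / cB * ((if y ∉ X₁ ω₁ then Mb (X₁ ω₁) (Y₁ ω₁) else 0) + (if y ∉ Y₁ ω₁ then M3 (X₁ ω₁) (Y₁ ω₁) else 0)) +
          ((if y ∈ X₁ ω₁ then M4 (X₁ ω₁) (Y₁ ω₁) else 0) + (if y ∈ Y₁ ω₁ then M1 (X₁ ω₁) (Y₁ ω₁) else 0))
      by_cases hyX : y ∈ X₁ ω₁ <;> by_cases hyY : y ∈ Y₁ ω₁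
      · rw [if_pos hyX, if_neg (not_not.2 hyY), if_pos hyX, if_neg (not_not.2 hyY), if_neg (not_not.2 hyX),
          if_neg (not_not.2 hyY), if_pos hyX, if_pos hyY]
        have := hrowM (X₁ ω₁) (Y₁ ω₁)
        have e0 : cR / cB * ((0 : ℝ) + 0) = 0 := by ring
        rw [e0, zero_add]; exact this
      · rw [if_pos hyX, if_pos hyY, if_pos hyX, if_pos hyY, if_neg (not_not.2 hyX), if_pos hyY, if_pos hyX, if_neg hyY]
        have := hrowA (X₁ ω₁) (Y₁ ω₁)
        have e0 : cR / cB * ((0 : ℝ) + M3 (X₁ ω₁) (Y₁ ω₁)) + (M4 (X₁ ω₁) (Y₁ ω₁) + 0) = cR / cB * M3 (X₁ ω₁) (Y₁ ω₁) + M4 (X₁ ω₁) (Y₁ ω₁) := by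
          ring
        rw [e0]; exact this
      · rw [if_neg hyX, if_neg (not_not.2 hyY), if_neg hyX, if_neg (not_not.2 hyY), if_pos hyX, if_neg (not_not.2 hyY), if_neg hyX,
          if_pos hyY]
        have := hrowC (X₁ ω₁) (Y₁ ω₁)
        have e0 : cR / cB * (Mb (X₁ ω₁) (Y₁ ω₁) + 0) + ((0 : ℝ) + M1 (X₁ ω₁) (Y₁ ω₁)) = cR / cB * Mb (X₁ ω₁) (Y₁ ω₁) + M1 (X₁ ω₁) (Y₁ ω₁) := by
          ring
        rw [e0]; exact this
      · rw [if_neg hyX, if_pos hyY, if_neg hyX, if_pos hyY, if_pos hyX, if_pos hyY, if_neg hyX, if_neg hyY]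
        have := hrowN (X₁ ω₁) (Y₁ ω₁)
        have e0 : cR / cB * (Mb (X₁ ω₁) (Y₁ ω₁) + M3 (X₁ ω₁) (Y₁ ω₁)) + ((0 : ℝ) + 0) = cR / cB * (Mb (X₁ ω₁) (Y₁ ω₁) + M3 (X₁ ω₁) (Y₁ ω₁)) := by
          ring
        rw [e0]; exact this
    refine le_trans ?_ hle
    rw [← Finset.mul_sum]
    exact mul_nonneg (mul_nonneg zero_le_two hcRpos.le) hcube
  show 0 ≤ ∑ ω₁ : Set (Sym2 V), (cR / cB * (if y ∉ X₁ ω₁ then Mb (X₁ ω₁) (Y₁ ω₁) else 0) + (if y ∈ X₁ ω₁ then M4 (X₁ ω₁) (Y₁ ω₁) else 0))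
  rw [hre]
  exact hmain

end Setting

end TwoStage

end Antithetic

end Summit.CriticalPhenomena.PercolationContinuityZ3.Theorems
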